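import Mathlib.LinearAlgebra.Matrix.Transvection
import Literature.Computability.AlgebraicComplexity.IMMCompleteness
import Literature.Computability.AlgebraicComplexity.BrentFormulaDepthCircuits
import Literature.Computability.AlgebraicComplexity.BLMW11FormulasWeaklySkew
import HarnessLib

/-!
# `(tr(M_1 ⋯ M_n))`, `3 × 3` matrices, is `VF`-complete (Ben-Or–Cleve 1992; Bürgisser 2024, §2.3)

P. Bürgisser, *Completeness classes in algebraic complexity theory* (survey, arXiv:2406.06217,
2024), §2.3, right after Def. 2.16 (completeness): "It is easy to provide an example of a
`VF`-complete sequence. Consider `g_n := tr(M_1 ⋯ M_n)`, where the `M_ν` are `3 × 3`-matrices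
whose entries are different variables. Using `M_1 ⋯ M_n = (M_1 ⋯ M_{n-1}) M_n`, we see that
`g_n` has expression size `O(n)`, thus `(g_n) ∈ VF`. In order to prove the `VF`-completeness of
`(g_n)` it suffices to verify that any polynomial `f` of expression size `m` is a projection of
`g_{t(m)}`, where `t(m) = O(m²)`; see [Ben-Or–Cleve 1992]." (held text p. 7, L83–L92), with
M. Ben-Or, R. Cleve, *Computing algebraic formulas using a constant number of registers*, SIAM J.
Comput. 21 (1992), Thm. 1 (a formula of depth `d` is computed by a linear straight-line program
of length `≤ 4^d` over three registers, i.e. by a word of elementary matrices `E_{ij}(x)`,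
`E_{ij}(c)` in `SL_3`).

In the tree's vocabulary `g_n` IS the iterated matrix multiplication polynomial
`immPoly 3 n R = IMM_{3,n} = tr(X^{(0)} ⋯ X^{(n-1)})` (`StandardFamilies.lean`), `VF = VP_e` is
rendered — as in `BLMW11FormulasWeaklySkew.lean`, `VBPDeterminantalComplexity.lean` — by p-bounded
expression size `IsPBounded (fun n => formulaComplexity (f n))` (Bürgisser 2024, Def. 2.8,
Cor. 2.14 (1)), and completeness is Def. 2.16: membership plus "every `(f_n) ∈ VF` is a
p-projection of `(g_n)`" (`IsPProjection`). Everything below holds over every commutative ring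
`R` and for families in arbitrary variable types. THEOREM-ONLY file: no definitions, no named
facts.

## Main statements

* `BenOrCleve.exists_word_of_circuit` — Ben-Or–Cleve, Thm. 1, on the tree's straight-line
  circuits `ArithCircuit`: a fan-in-two circuit of depth `d` computing `f` gives a list of at most
  `6 · 4^d` matrices of format `3 × 3` all of whose entries are VARIABLES OR CONSTANTS, with
  product `E_{02}(f) = 1 + f · e_0 e_2ᵀ`;
* `BenOrCleve.isProjection_immPoly_three` — hence `f` is a projection of `IMM_{3, M+1}` for every
  `M ≥ 6 · 4^d` (`tr(e_2 e_0ᵀ · E_{02}(f)) = f`, spare layers set to unit matrices);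
* `BenOrCleve.isProjection_immPoly_three_of_formulaComplexity_le` — with Brent's depth reduction
  (the tree's `exists_formula_four_pow_depth_le`: `4^{depth} ≤ (E(f)+1)^{16}`): expression size
  `≤ s` ⟹ projection of `IMM_{3, 6(s+1)^16 + 1}`;
  `BenOrCleve.isPProjection_immPoly_three_of_isPBounded_formulaComplexity` — every `VF` family is
  a p-projection of `(IMM_{3,n})_n` (hardness);
* `BenOrCleve.formulaComplexity_immPoly_three_le` — `E(IMM_{3,n}) ≤ 24 (n+1)^3`, and
  `BenOrCleve.isPBounded_formulaComplexity_immPoly_three` — `(IMM_{3,n})_n ∈ VF` (membership);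
* `BenOrCleve.Bur24_immPoly_three_VFComplete` — **`(tr(M_1 ⋯ M_n))_n`, `3 × 3` matrices, is
  `VF`-complete**; `BenOrCleve.isPBounded_formulaComplexity_iff_isPProjection_immPoly_three` —
  `(f_n) ∈ VF ⟺ (f_n)` is a p-projection of `(IMM_{3,n})_n`.

## Proof (following Ben-Or–Cleve; where we deviate)

Ben-Or–Cleve prove the "offset" invariant: every gate value `g` of depth `d` has, for EVERY
ordered pair `i ≠ i'` of registers and EVERY scalar `c`, a program of length `≤ 4^d` with effect
`E_{i i'}(c · g)`; sums concatenate (`E(a) E(b) = E(a+b)`), products are the Steinberg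
commutator `E_{ik}(a) E_{ki'}(b) E_{ik}(-a) E_{ki'}(-b) = E_{ii'}(ab)` through the third register
`k` (`transvection_commutator`) — four sub-words. We run the same reverse induction on the gate
list (`word_of_operand`, `word_of_gate`, `word_of_gates`; semantics `gateValues` and depths
`gateWDepths` read with `List.getD · 0`, junk references having value `0 = ` empty word).
Deviation (forced by Valiant projections, which substitute variables and constants only, not
`-x`): the leaf `E_{i i'}(c · x_v)` is not one letter but the six-letter word
`E_{ik}(c) E_{ki'}(x_v) E_{ik}(-c) · D_k E_{ki'}(x_v) D_k`, `D_k = diag(-1 at k)`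
(`transvection_neg_eq_conj`, `word_var`), whence the constant `6` in `6 · 4^d`. Membership:
the survey's "`O(n)`" counts the linear recursion `(M_1 ⋯ M_{n-1}) M_n` as a straight-line
computation; for the tree's sharing-free `formulaComplexity` we use the balanced product tree
instead (`formulaComplexity_prod_apply_succ_le`: entries of a product of `2^j` letters have
`E + 1 ≤ 6^j`), giving the cubic bound. NOT FORMALISED: the printed `t(m) = O(m²)` (Brent's
optimal depth constant; here `t(m) = 6(m+1)^16 + 1`) — TODO(sharper form); Ben-Or–Cleve's
converse direction (programs to formulas) is not needed for completeness and is omitted.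
The Summits-side support file `Summits/ValiantsHypothesis/…/Theorems/ElementaryWordLengthBocSimulation.lean`
proves the transvection-word form of Thm. 1 for a route (letters `E_{ij}(λ)`, `E_{ij}(λ x)`);
Literature cannot import Summits, and the projection argument needs the variable/constant letter
alphabet, so the simulation is re-run here in that alphabet.

## References

* [Burgisser2024Completeness] P. Bürgisser, Completeness classes in algebraic complexity theory,
  arXiv:2406.06217 (2024), §2.3 (held text p. 7, L83–L92), Def. 2.8, Def. 2.16, Cor. 2.14.
* [BenOrCleve1992] M. Ben-Or, R. Cleve, Computing algebraic formulas using a constant number of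
  registers, SIAM J. Comput. 21 (1) (1992) 54–58, Thm. 1.
* [BurgisserClausenShokrollahi1997] P. Bürgisser, M. Clausen, M. A. Shokrollahi, Algebraic
  Complexity Theory, Springer 1997, §21.1, p. 549 and (21.19) (expression size `E`, its
  subadditivity under `+`, `·`).
-/

noncomputable section

open MvPolynomial Matrix

namespace Literature.Computability.AlgebraicComplexity

universe u v

namespace BenOrCleve

variable {R : Type u} [CommRing R] {σ : Type v}

/-! ## §1. Letters: `3 × 3` matrices with variable/constant entries -/

/-- The Steinberg commutator relation for elementary matrices over a commutative ring: for
pairwise distinct indices `i, k, j`,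
`E_{ik}(a) · E_{kj}(b) · E_{ik}(-a) · E_{kj}(-b) = E_{ij}(a b)` (Ben-Or–Cleve 1992, proof of
Thm. 1). [cite: BenOrCleve1992, Thm. 1 (proof)] -/
theorem transvection_commutator {n : Type*} [Fintype n] [DecidableEq n] {i k j : n}
    (hik : i ≠ k) (hkj : k ≠ j) (hij : i ≠ j) (a b : MvPolynomial σ R) :
    transvection i k a * transvection k j b * transvection i k (-a) * transvection k j (-b) =
      transvection i j (a * b) := by
  simp only [transvection, mul_add, add_mul, one_mul, mul_one, single_mul_single_same,
    single_mul_single_of_ne _ _ _ _ hik.symm, single_mul_single_of_ne _ _ _ _ hkj.symm,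
    single_mul_single_of_ne _ _ _ _ hij.symm, add_zero, ← single_neg, mul_neg, neg_mul]
  abel

/-- In `Fin 3` every ordered pair of distinct indices has a third index (the auxiliary register
of Ben-Or–Cleve 1992, Thm. 1). [cite: BenOrCleve1992, Thm. 1 (proof)] -/
theorem exists_third_index {i i' : Fin 3} (h : i ≠ i') : ∃ k : Fin 3, k ≠ i ∧ k ≠ i' := by
  revert i i'
  decide

/-- **Negating a transvection by a sign conjugation**: for `k ≠ j`,
`E_{kj}(-a) = D · E_{kj}(a) · D` with `D = diag(…, −1 at k, …)` (so that a word over elementary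
matrices with entries `±x` becomes a word over matrices with entries in `{x} ∪ R`, as a Valiant
projection needs). [cite: BenOrCleve1992, Thm. 1 (proof)] -/
theorem transvection_neg_eq_conj {n : Type*} [Fintype n] [DecidableEq n] {k j : n} (hkj : k ≠ j)
    (a : MvPolynomial σ R) :
    transvection k j (-a) =
      Matrix.diagonal (fun l => if l = k then (-1 : MvPolynomial σ R) else 1) *
        transvection k j a * Matrix.diagonal (fun l => if l = k then (-1 : MvPolynomial σ R) else 1) := by
  refine Matrix.ext fun a' b' => ?_
  rw [Matrix.mul_diagonal, Matrix.diagonal_mul]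
  simp only [transvection, Matrix.add_apply, Matrix.single_apply]
  by_cases hab : a' = b'
  · subst hab
    have hkj' : ¬ (k = a' ∧ j = a') := fun h => hkj (h.1.trans h.2.symm)
    rw [if_neg hkj', if_neg hkj', Matrix.one_apply_eq, add_zero]
    split_ifs <;> ring
  · rw [Matrix.one_apply_ne hab, zero_add, zero_add]
    by_cases h1 : k = a' ∧ j = b'
    · obtain ⟨rfl, rfl⟩ := h1
      simp only [and_self, if_true, if_neg hkj.symm]
      ring
    · rw [if_neg h1, if_neg h1, mul_zero, zero_mul]

/-- Entries of a transvection `E_{ij}(e)`, `i ≠ j`, are `1`, `0` or `e`: if `e` is a variable or a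
constant, so are all entries. [cite: BenOrCleve1992, Thm. 1 (proof)] -/
theorem transvection_isVarOrConst {n : Type*} [DecidableEq n] {i j : n} (hij : i ≠ j)
    {e : MvPolynomial σ R} (he : (∃ x, e = X x) ∨ ∃ c, e = C c) (a b : n) :
    (∃ x, transvection i j e a b = X x) ∨ ∃ c, transvection i j e a b = C c := by
  simp only [transvection, Matrix.add_apply, Matrix.single_apply]
  by_cases hab : a = b
  · subst hab
    have hij' : ¬ (i = a ∧ j = a) := fun h => hij (h.1.trans h.2.symm)
    rw [Matrix.one_apply_eq, if_neg hij', add_zero]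
    exact Or.inr ⟨1, (map_one C).symm⟩
  · rw [Matrix.one_apply_ne hab, zero_add]
    split_ifs
    · exact he
    · exact Or.inr ⟨0, (map_zero C).symm⟩

/-- Entries of a diagonal sign matrix are constants. [cite: BenOrCleve1992, Thm. 1 (proof)] -/
theorem diagonalSign_isVarOrConst {n : Type*} [DecidableEq n] (k : n) (a b : n) :
    (∃ x, Matrix.diagonal (fun l => if l = k then (-1 : MvPolynomial σ R) else 1) a b = X x) ∨
      ∃ c, Matrix.diagonal (fun l => if l = k then (-1 : MvPolynomial σ R) else 1) a b = C c := by
  by_cases hab : a = b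
  · subst hab
    rw [Matrix.diagonal_apply_eq]
    split_ifs
    · exact Or.inr ⟨-1, by rw [map_neg, map_one]⟩
    · exact Or.inr ⟨1, (map_one C).symm⟩
  · rw [Matrix.diagonal_apply_ne _ hab]
    exact Or.inr ⟨0, (map_zero C).symm⟩

/-! ## §2. Words of letters and the Ben-Or–Cleve simulation

A *word* is a list of `3 × 3` matrices over `R[X_σ]` all of whose entries are variables or
constants (so that its product, read as one factor per matrix, is a Valiant projection of the
iterated matrix multiplication polynomial); we carry the admissibility condition explicitly. -/

/-- The empty word. [cite: BenOrCleve1992, Thm. 1 (proof)] -/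
theorem word_one (B : ℕ) :
    ∃ w : List (Matrix (Fin 3) (Fin 3) (MvPolynomial σ R)), w.length ≤ B ∧
      (∀ M ∈ w, ∀ a b, (∃ x, M a b = X x) ∨ ∃ c, M a b = C c) ∧
      w.prod = (1 : Matrix (Fin 3) (Fin 3) (MvPolynomial σ R)) :=
  ⟨[], Nat.zero_le _, by simp, by simp⟩

/-- Concatenation of words multiplies their products and adds their lengths.
[cite: BenOrCleve1992, Thm. 1 (proof)] -/
theorem word_mul {B₁ B₂ : ℕ} {M N : Matrix (Fin 3) (Fin 3) (MvPolynomial σ R)}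
    (hM : ∃ w : List (Matrix (Fin 3) (Fin 3) (MvPolynomial σ R)), w.length ≤ B₁ ∧
      (∀ M ∈ w, ∀ a b, (∃ x, M a b = X x) ∨ ∃ c, M a b = C c) ∧ w.prod = M)
    (hN : ∃ w : List (Matrix (Fin 3) (Fin 3) (MvPolynomial σ R)), w.length ≤ B₂ ∧
      (∀ M ∈ w, ∀ a b, (∃ x, M a b = X x) ∨ ∃ c, M a b = C c) ∧ w.prod = N) :
    ∃ w : List (Matrix (Fin 3) (Fin 3) (MvPolynomial σ R)), w.length ≤ B₁ + B₂ ∧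
      (∀ M ∈ w, ∀ a b, (∃ x, M a b = X x) ∨ ∃ c, M a b = C c) ∧ w.prod = M * N := by
  obtain ⟨w₁, h₁, hv₁, hp₁⟩ := hM
  obtain ⟨w₂, h₂, hv₂, hp₂⟩ := hN
  refine ⟨w₁ ++ w₂, by simpa using Nat.add_le_add h₁ h₂, ?_, ?_⟩
  · intro l hl
    rcases List.mem_append.1 hl with hl | hl
    exacts [hv₁ l hl, hv₂ l hl]
  · rw [List.prod_append, hp₁, hp₂]

/-- A constant letter `E_{i i'}(c)`. [cite: BenOrCleve1992, Thm. 1 (proof)] -/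
theorem word_const {i i' : Fin 3} (h : i ≠ i') (c : R) :
    ∃ w : List (Matrix (Fin 3) (Fin 3) (MvPolynomial σ R)), w.length ≤ 1 ∧
      (∀ M ∈ w, ∀ a b, (∃ x, M a b = X x) ∨ ∃ c, M a b = C c) ∧
      w.prod = transvection i i' (C c) := by
  refine ⟨[transvection i i' (C c)], le_rfl, ?_, by simp⟩
  intro M hM a b
  rw [List.mem_singleton] at hM
  subst hM
  exact transvection_isVarOrConst h (Or.inr ⟨c, rfl⟩) a b

/-- **A variable leaf `E_{i i'}(c · x_v)` is a word of six letters** with variable/constant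
entries: with the third index `k`,
`E_{i i'}(c x) = E_{ik}(c) E_{ki'}(x) E_{ik}(−c) (D_k E_{ki'}(x) D_k)` (Steinberg commutator,
the negative variable letter realised by the sign conjugation `transvection_neg_eq_conj`).
[cite: BenOrCleve1992, Thm. 1 (proof)] -/
theorem word_var {i i' : Fin 3} (h : i ≠ i') (c : R) (v : σ) :
    ∃ w : List (Matrix (Fin 3) (Fin 3) (MvPolynomial σ R)), w.length ≤ 6 ∧
      (∀ M ∈ w, ∀ a b, (∃ x, M a b = X x) ∨ ∃ c, M a b = C c) ∧
      w.prod = transvection i i' (C c * X v) := by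
  obtain ⟨kk, hki, hki'⟩ := exists_third_index h
  refine ⟨[transvection i kk (C c), transvection kk i' (X v), transvection i kk (C (-c)),
    Matrix.diagonal (fun l => if l = kk then (-1 : MvPolynomial σ R) else 1),
    transvection kk i' (X v),
    Matrix.diagonal (fun l => if l = kk then (-1 : MvPolynomial σ R) else 1)], by simp, ?_, ?_⟩
  · intro M hM a b
    simp only [List.mem_cons, List.mem_nil_iff, or_false] at hM
    rcases hM with rfl | rfl | rfl | rfl | rfl | rfl
    · exact transvection_isVarOrConst hki.symm (Or.inr ⟨c, rfl⟩) a b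
    · exact transvection_isVarOrConst hki' (Or.inl ⟨v, rfl⟩) a b
    · exact transvection_isVarOrConst hki.symm (Or.inr ⟨-c, rfl⟩) a b
    · exact diagonalSign_isVarOrConst kk a b
    · exact transvection_isVarOrConst hki' (Or.inl ⟨v, rfl⟩) a b
    · exact diagonalSign_isVarOrConst kk a b
  · simp only [List.prod_cons, List.prod_nil, mul_one]
    rw [show transvection i kk (C c) * (transvection kk i' (X v) * (transvection i kk (C (-c)) *
        (Matrix.diagonal (fun l => if l = kk then (-1 : MvPolynomial σ R) else 1) *
          (transvection kk i' (X v) *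
            Matrix.diagonal (fun l => if l = kk then (-1 : MvPolynomial σ R) else 1))))) =
        transvection i kk (C c) * transvection kk i' (X v) * transvection i kk (-(C c)) *
          (Matrix.diagonal (fun l => if l = kk then (-1 : MvPolynomial σ R) else 1) *
            transvection kk i' (X v) *
            Matrix.diagonal (fun l => if l = kk then (-1 : MvPolynomial σ R) else 1)) by
      rw [map_neg]; simp only [mul_assoc],
      ← transvection_neg_eq_conj hki', transvection_commutator hki.symm hki' h]

/-- An element of a list is bounded by the `max`-fold of the list. [folklore] -/
private theorem le_foldr_max_of_mem {α : Type*} (f : α → ℕ) {l : List α} {x : α} (hx : x ∈ l) :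
    f x ≤ (l.map f).foldr max 0 := by
  induction l with
  | nil => simp at hx
  | cons y l ih =>
    rw [List.map_cons, List.foldr_cons]
    rcases List.mem_cons.1 hx with rfl | hx
    · exact le_max_left _ _
    · exact (ih hx).trans (le_max_right _ _)

/-- The arithmetic of Ben-Or–Cleve's length bound: four sub-words of length `≤ 6 · 4^D` fit into
`6 · 4^(1+D)`. [cite: BenOrCleve1992, Thm. 1 (proof)] -/
private theorem four_pow_bound {d e D : ℕ} (hd : d ≤ D) (he : e ≤ D) :
    6 * 4 ^ d + 6 * 4 ^ e + 6 * 4 ^ d + 6 * 4 ^ e ≤ 6 * 4 ^ (1 + D) := by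
  have h₁ : 4 ^ d ≤ 4 ^ D := Nat.pow_le_pow_right (by norm_num) hd
  have h₂ : 4 ^ e ≤ 4 ^ D := Nat.pow_le_pow_right (by norm_num) he
  rw [pow_add, pow_one]
  omega

/-- **Operands** (Ben-Or–Cleve 1992, Thm. 1, leaves and recursive calls): under the offset
invariant for gate references, every operand `u` has, for every pair `i ≠ i'` and scalar `c`, a
word of length `≤ 6 · 4^{depth u}` with product `E_{i i'}(c · u)`.
[cite: BenOrCleve1992, Thm. 1] -/
theorem word_of_operand (vals : List (MvPolynomial σ R)) (ds : List ℕ)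
    (hinv : ∀ (j : ℕ) (i i' : Fin 3), i ≠ i' → ∀ c : R,
      ∃ w : List (Matrix (Fin 3) (Fin 3) (MvPolynomial σ R)), w.length ≤ 6 * 4 ^ ds.getD j 0 ∧
        (∀ M ∈ w, ∀ a b, (∃ x, M a b = X x) ∨ ∃ c, M a b = C c) ∧
        w.prod = transvection i i' (C c * vals.getD j 0))
    (u : ArithCircuit.Operand R σ) {i i' : Fin 3} (h : i ≠ i') (c : R) :
    ∃ w : List (Matrix (Fin 3) (Fin 3) (MvPolynomial σ R)),
      w.length ≤ 6 * 4 ^ ArithCircuit.Operand.depthIn ds u ∧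
      (∀ M ∈ w, ∀ a b, (∃ x, M a b = X x) ∨ ∃ c, M a b = C c) ∧
      w.prod = transvection i i' (C c * u.eval vals) := by
  cases u with
  | var v =>
    obtain ⟨w, hw, hv, hp⟩ := word_var (R := R) h c v
    refine ⟨w, ?_, hv, ?_⟩
    · simpa [ArithCircuit.Operand.depthIn] using hw
    · rw [hp]
      simp [ArithCircuit.Operand.eval]
  | const a =>
    obtain ⟨w, hw, hv, hp⟩ := word_const (σ := σ) h (c * a)
    refine ⟨w, ?_, hv, ?_⟩
    · have : (1 : ℕ) ≤ 6 * 4 ^ ArithCircuit.Operand.depthIn ds (ArithCircuit.Operand.const a : ArithCircuit.Operand R σ) := by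
        simp [ArithCircuit.Operand.depthIn]
      exact hw.trans this
    · rw [hp]
      simp [ArithCircuit.Operand.eval, C_mul]
  | gate j =>
    simpa [ArithCircuit.Operand.depthIn, ArithCircuit.Operand.eval] using hinv j i i' h c

/-- **Gates** (Ben-Or–Cleve 1992, Thm. 1): under the offset invariant for the earlier gates, a
gate of fan-in `≤ 2` has, for every pair `i ≠ i'` and scalar `c`, a word of length
`≤ 6 · 4^(1 + max depths)` with product `E_{i i'}(c · value)`: sums concatenate, products are the
Steinberg commutator through the third index. [cite: BenOrCleve1992, Thm. 1] -/
theorem word_of_gate (vals : List (MvPolynomial σ R)) (ds : List ℕ)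
    (hinv : ∀ (j : ℕ) (i i' : Fin 3), i ≠ i' → ∀ c : R,
      ∃ w : List (Matrix (Fin 3) (Fin 3) (MvPolynomial σ R)), w.length ≤ 6 * 4 ^ ds.getD j 0 ∧
        (∀ M ∈ w, ∀ a b, (∃ x, M a b = X x) ∨ ∃ c, M a b = C c) ∧
        w.prod = transvection i i' (C c * vals.getD j 0))
    (g : ArithCircuit.Gate R σ) (hg : g.fanIn ≤ 2) {i i' : Fin 3} (h : i ≠ i') (c : R) :
    ∃ w : List (Matrix (Fin 3) (Fin 3) (MvPolynomial σ R)),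
      w.length ≤ 6 * 4 ^ (1 + (g.args.map (ArithCircuit.Operand.depthIn ds)).foldr max 0) ∧
      (∀ M ∈ w, ∀ a b, (∃ x, M a b = X x) ∨ ∃ c, M a b = C c) ∧
      w.prod = transvection i i' (C c * g.eval vals) := by
  have hop := word_of_operand vals ds hinv
  have hD : ∀ u ∈ g.args, ArithCircuit.Operand.depthIn ds u ≤
      (g.args.map (ArithCircuit.Operand.depthIn ds)).foldr max 0 :=
    fun u hu => le_foldr_max_of_mem _ hu
  generalize (g.args.map (ArithCircuit.Operand.depthIn ds)).foldr max 0 = D at hD ⊢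
  have hD1 : ∀ d, d ≤ D → 6 * 4 ^ d ≤ 6 * 4 ^ (1 + D) := fun d hd =>
    Nat.mul_le_mul_left 6 (Nat.pow_le_pow_right (by norm_num) (by omega))
  have h6 : (1 : ℕ) ≤ 6 * 4 ^ (1 + D) := le_trans (by norm_num) (Nat.mul_le_mul_left 6 (Nat.one_le_pow _ _ (by norm_num)))
  cases g with
  | sum args =>
    rcases args with _ | ⟨a, _ | ⟨b, _ | ⟨e, rest⟩⟩⟩
    · -- empty sum: value `0`, the empty word
      obtain ⟨w, hw, hv, hp⟩ := word_one (R := R) (σ := σ) 0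
      refine ⟨w, hw.trans (Nat.zero_le _), hv, ?_⟩
      rw [hp]
      simp [ArithCircuit.Gate.eval]
    · -- one summand `a.1 • a.2`
      obtain ⟨w, hw, hv, hp⟩ := hop a.2 h (c * a.1)
      refine ⟨w, hw.trans (hD1 _ (hD a.2 (by simp [ArithCircuit.Gate.args]))), hv, ?_⟩
      rw [hp]
      simp only [ArithCircuit.Gate.eval, List.map_cons, List.map_nil, List.sum_cons, List.sum_nil,
        add_zero, smul_eq_C_mul, C_mul, mul_assoc]
    · -- two summands: concatenate
      obtain ⟨w, hw, hv, hp⟩ := word_mul (hop a.2 h (c * a.1)) (hop b.2 h (c * b.1))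
      refine ⟨w, hw.trans ?_, hv, ?_⟩
      · have := four_pow_bound (hD a.2 (by simp [ArithCircuit.Gate.args]))
          (hD b.2 (by simp [ArithCircuit.Gate.args]))
        omega
      · rw [hp, transvection_mul_transvection_same _ _ h]
        congr 1
        simp only [ArithCircuit.Gate.eval, List.map_cons, List.map_nil, List.sum_cons,
          List.sum_nil, add_zero, smul_eq_C_mul, C_mul, mul_add]
        ring
    · simp [ArithCircuit.Gate.fanIn, ArithCircuit.Gate.args] at hg
  | prod args =>
    rcases args with _ | ⟨u, _ | ⟨v, _ | ⟨e, rest⟩⟩⟩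
    · -- empty product: value `1`, one letter `E_{i i'}(c)`
      obtain ⟨w, hw, hv, hp⟩ := word_const (σ := σ) h c
      refine ⟨w, hw.trans h6, hv, ?_⟩
      rw [hp]
      simp [ArithCircuit.Gate.eval]
    · -- one factor
      obtain ⟨w, hw, hv, hp⟩ := hop u h c
      refine ⟨w, hw.trans (hD1 _ (hD u (by simp [ArithCircuit.Gate.args]))), hv, ?_⟩
      rw [hp]
      simp [ArithCircuit.Gate.eval]
    · -- two factors: the Steinberg commutator through the third index `k`
      obtain ⟨kk, hki, hki'⟩ := exists_third_index h
      obtain ⟨w, hw, hv, hp⟩ := word_mul (word_mul (word_mul (hop u hki.symm c) (hop v hki' 1))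
        (hop u hki.symm (-c))) (hop v hki' (-1))
      refine ⟨w, hw.trans ?_, hv, ?_⟩
      · have := four_pow_bound (hD u (by simp [ArithCircuit.Gate.args]))
          (hD v (by simp [ArithCircuit.Gate.args]))
        omega
      · rw [hp]
        have hu : C (-c) * u.eval vals = -(C c * u.eval vals) := by simp
        have hv' : C (-1 : R) * v.eval vals = -(C 1 * v.eval vals) := by simp
        rw [hu, hv', transvection_commutator hki.symm hki' h]
        congr 1
        simp [ArithCircuit.Gate.eval, mul_assoc]
    · simp [ArithCircuit.Gate.fanIn, ArithCircuit.Gate.args] at hg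

/-- **The offset invariant along the gate list** (Ben-Or–Cleve 1992, Thm. 1, induction on the
straight-line program): for a fan-in-two gate list, every gate reference `j` (junk references
included: value `0`, depth `0`) has, for every pair `i ≠ i'` and scalar `c`, a word of length
`≤ 6 · 4^{depth_j}` with product `E_{i i'}(c · value_j)`. [cite: BenOrCleve1992, Thm. 1] -/
theorem word_of_gates (gs : List (ArithCircuit.Gate R σ)) (hgs : ∀ g ∈ gs, g.fanIn ≤ 2) (j : ℕ)
    {i i' : Fin 3} (h : i ≠ i') (c : R) :
    ∃ w : List (Matrix (Fin 3) (Fin 3) (MvPolynomial σ R)),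
      w.length ≤ 6 * 4 ^ (ArithCircuit.gateWDepths (fun _ => 1) gs).getD j 0 ∧
      (∀ M ∈ w, ∀ a b, (∃ x, M a b = X x) ∨ ∃ c, M a b = C c) ∧
      w.prod = transvection i i' (C c * (ArithCircuit.gateValues gs).getD j 0) := by
  induction gs using List.reverseRecOn generalizing j i i' c with
  | nil =>
    obtain ⟨w, hw, hv, hp⟩ := word_one (R := R) (σ := σ) 0
    refine ⟨w, hw.trans (Nat.zero_le _), hv, ?_⟩
    rw [hp]
    simp [ArithCircuit.gateValues]
  | append_singleton gs g ih =>
    have hgs' : ∀ g' ∈ gs, g'.fanIn ≤ 2 := fun g' hg' => hgs g' (List.mem_append_left _ hg')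
    have hg : g.fanIn ≤ 2 := hgs g (by simp)
    have hlen₁ := ArithCircuit.gateWDepths_length (fun _ : ArithCircuit.Gate R σ => 1) gs
    have hlen₂ := ArithCircuit.gateValues_length (k := R) gs
    rw [ArithCircuit.gateWDepths_append_singleton, ArithCircuit.gateValues_append_singleton]
    rcases Nat.lt_trichotomy j gs.length with hj | rfl | hj
    · rw [List.getD_append _ _ _ _ (by omega), List.getD_append _ _ _ _ (by omega)]
      exact ih hgs' j h c
    · rw [List.getD_append_right _ _ _ _ (by omega), List.getD_append_right _ _ _ _ (by omega),
        hlen₁, hlen₂, Nat.sub_self, List.getD_cons_zero, List.getD_cons_zero]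
      exact word_of_gate _ _ (fun j i i' h c => ih hgs' j h c) g hg h c
    · rw [List.getD_eq_default _ _ (by simp; omega), List.getD_eq_default _ _ (by simp; omega)]
      obtain ⟨w, hw, hv, hp⟩ := word_one (R := R) (σ := σ) 0
      refine ⟨w, hw.trans (Nat.zero_le _), hv, ?_⟩
      rw [hp]
      simp

/-- **Ben-Or–Cleve, Thm. 1, as a word of variable/constant matrices**: a fan-in-two arithmetic
circuit `P` of depth `d` computing `f` (over any commutative ring, any variables) yields a word of
at most `6 · 4^d` matrices of format `3 × 3` whose entries are variables or constants and whose
product is the transvection `E_{02}(f) = 1 + f e_0 e_2ᵀ` ("polynomial-size formulas are computed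
by linear-length width-3 straight-line programs"). [cite: BenOrCleve1992, Thm. 1] -/
theorem exists_word_of_circuit (P : ArithCircuit R σ) (h2 : P.IsFanInTwo) :
    ∃ w : List (Matrix (Fin 3) (Fin 3) (MvPolynomial σ R)), w.length ≤ 6 * 4 ^ P.depth ∧
      (∀ M ∈ w, ∀ a b, (∃ x, M a b = X x) ∨ ∃ c, M a b = C c) ∧
      w.prod = transvection 0 2 P.eval := by
  obtain ⟨w, hw, hv, hp⟩ := word_of_operand (ArithCircuit.gateValues P.gates)
    (ArithCircuit.gateWDepths (fun _ => 1) P.gates)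
    (fun j i i' h c => word_of_gates P.gates h2 j h c) P.output (show (0 : Fin 3) ≠ 2 by decide)
    (1 : R)
  refine ⟨w, hw, hv, ?_⟩
  rw [hp, C_1, one_mul]
  rfl

/-! ## §3. Read-out: the value of a circuit of depth `d` is a projection of `IMM_{3, N}`,
`N > 6 · 4^d` -/

/-- A list read through `getD · 1` along `Fin M`, `M ≥ length`, multiplies to the product of the
list (the missing positions contribute unit matrices). [folklore] -/
private theorem prod_map_getD_finRange {S : Type*} [Monoid S] :
    ∀ (M : ℕ) (w : List S), w.length ≤ M →
      ((List.finRange M).map fun l : Fin M => w.getD (l : ℕ) 1).prod = w.prod := by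
  intro M
  induction M with
  | zero =>
    intro w hw
    rw [List.length_eq_zero_iff.1 (Nat.le_zero.1 hw)]
    simp
  | succ M ih =>
    intro w hw
    rw [List.finRange_succ, List.map_cons, List.prod_cons, List.map_map]
    cases w with
    | nil =>
      have h1 := ih [] (Nat.zero_le _)
      simp only [List.getD_nil, List.prod_nil] at h1 ⊢
      rw [one_mul]
      simp [Function.comp_def]
    | cons x w' =>
      simp only [Fin.val_zero, List.getD_cons_zero, List.prod_cons]
      have : ((fun l : Fin (M + 1) => (x :: w').getD (l : ℕ) 1) ∘ Fin.succ) =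
          fun l : Fin M => w'.getD (l : ℕ) 1 := by
        funext l; simp [Fin.val_succ]
      rw [this, ih w' (by simpa using hw)]

/-- The factors "`C`, then the word, then unit matrices" multiply to `C · ∏ word`. [folklore] -/
private theorem prod_map_headWord_finRange {S : Type*} [Monoid S] (Cm : S) (w : List S) {M : ℕ}
    (hw : w.length ≤ M) :
    ((List.finRange (M + 1)).map fun l : Fin (M + 1) =>
        if (l : ℕ) = 0 then Cm else w.getD ((l : ℕ) - 1) 1).prod = Cm * w.prod := by
  rw [List.finRange_succ, List.map_cons, List.prod_cons, List.map_map]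
  simp only [Fin.val_zero, if_true]
  have : ((fun l : Fin (M + 1) => if (l : ℕ) = 0 then Cm else w.getD ((l : ℕ) - 1) 1) ∘ Fin.succ) =
      fun l : Fin M => w.getD (l : ℕ) 1 := by
    funext l
    simp only [Function.comp_apply, Fin.val_succ, Nat.succ_ne_zero, if_false, Nat.add_sub_cancel]
  rw [this, prod_map_getD_finRange M w hw]

/-- **The value of a fan-in-two circuit of depth `d` is a projection of `IMM_{3, M+1}` for every
`M ≥ 6 · 4^d`** (Ben-Or–Cleve 1992, Thm. 1, read as a Valiant projection; Bürgisser 2024, §2.3: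
"any polynomial `f` of expression size `m` is a projection of `g_{t(m)}`"): the `IMM` variables of
layer `0` are sent to the constant matrix `e_2 e_0ᵀ`, those of layers `1, …, L` to the letters of
the word of `exists_word_of_circuit`, the remaining layers to unit matrices, and
`tr(e_2 e_0ᵀ · E_{02}(f)) = f`. [cite: BenOrCleve1992, Thm. 1] [cite: Burgisser2024Completeness, §2.3 (p0007 L83–L92)] -/
theorem isProjection_immPoly_three (P : ArithCircuit R σ) (h2 : P.IsFanInTwo) {M : ℕ}
    (hM : 6 * 4 ^ P.depth ≤ M) : IsProjection P.eval (immPoly 3 (M + 1) R) := by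
  classical
  obtain ⟨w, hw, hv, hp⟩ := exists_word_of_circuit P h2
  have hwM : w.length ≤ M := hw.trans hM
  let Cm : Matrix (Fin 3) (Fin 3) (MvPolynomial σ R) := Matrix.single 2 0 (C 1)
  let A : Fin (M + 1) → Matrix (Fin 3) (Fin 3) (MvPolynomial σ R) := fun l =>
    if (l : ℕ) = 0 then Cm else w.getD ((l : ℕ) - 1) 1
  refine ⟨fun v => A v.1 v.2.1 v.2.2, ?_, ?_⟩
  · -- every substituted entry is a variable or a constant
    have h0 : (∃ x, (0 : MvPolynomial σ R) = X x) ∨ ∃ c, (0 : MvPolynomial σ R) = C c :=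
      Or.inr ⟨0, (map_zero C).symm⟩
    have hone : ∀ a b : Fin 3, (∃ x, (1 : Matrix (Fin 3) (Fin 3) (MvPolynomial σ R)) a b = X x) ∨
        ∃ c, (1 : Matrix (Fin 3) (Fin 3) (MvPolynomial σ R)) a b = C c := by
      intro a b
      by_cases hab : a = b
      · subst hab; exact Or.inr ⟨1, by rw [Matrix.one_apply_eq, map_one]⟩
      · rw [Matrix.one_apply_ne hab]; exact h0
    rintro ⟨l, a, b⟩
    dsimp only [A]
    split_ifs
    · simp only [Cm, Matrix.single_apply]
      split_ifs
      · exact Or.inr ⟨1, rfl⟩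
      · exact h0
    · by_cases hl : (l : ℕ) - 1 < w.length
      · rw [List.getD_eq_getElem _ _ hl]
        exact hv _ (List.getElem_mem hl) a b
      · rw [List.getD_eq_default _ _ (not_lt.1 hl)]
        exact hone a b
  · -- the value
    rw [LayeredAutomaton.aeval_immPoly_eq_trace]
    have hA : (fun l : Fin (M + 1) => (Matrix.of fun a b => A l a b)) = A := by
      funext l; ext a b; rfl
    rw [hA, prod_map_headWord_finRange Cm w hwM, hp, Matrix.trace_single_mul, smul_eq_mul,
      map_one, one_mul, transvection, Matrix.add_apply, Matrix.one_apply_ne (by decide), zero_add,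
      Matrix.single_apply_same]

/-! ## §4. `VF`-hardness: every polynomial of expression size `s` is a projection of
`IMM_{3, 6(s+1)^16 + 1}`; `VF` families are p-projections of `(IMM_{3,n})_n` -/

/-- **Expression size `s` ⟹ projection of `IMM_{3, 6(s+1)^{16}+1}`** (Ben-Or–Cleve with Brent's
depth reduction `4^{depth} ≤ (E(f)+1)^{16}`, the tree's `exists_formula_four_pow_depth_le`; the
printed `t(m) = O(m²)` uses Brent's optimal constant, not available here — TODO(sharper form)).
[cite: BenOrCleve1992, Thm. 1] [cite: Burgisser2024Completeness, §2.3 (p0007 L83–L92)] -/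
theorem isProjection_immPoly_three_of_formulaComplexity_le (f : MvPolynomial σ R)
    {s : ℕ} (hs : formulaComplexity f ≤ s) :
    IsProjection f (immPoly 3 (6 * (s + 1) ^ 16 + 1) R) := by
  obtain ⟨P, _, _, h2, hPf, hPd⟩ := exists_formula_four_pow_depth_le f
  rw [← hPf]
  refine isProjection_immPoly_three P h2 ?_
  exact Nat.mul_le_mul_left 6 (hPd.trans (Nat.pow_le_pow_left (Nat.succ_le_succ hs) 16))

/-- **Every `VF` family is a p-projection of `(IMM_{3,n})_n`** (the hardness half of the
`VF`-completeness of `g_n = tr(M_1 ⋯ M_n)`, `3 × 3` matrices; Bürgisser 2024 §2.3 after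
[Ben-Or–Cleve 1992]), `VF` rendered by p-bounded expression size, families in arbitrary variable
types, every commutative ring. [cite: Burgisser2024Completeness, §2.3 (p0007 L83–L92)]
[cite: BenOrCleve1992, Thm. 1] -/
theorem isPProjection_immPoly_three_of_isPBounded_formulaComplexity {τ : ℕ → Type v}
    {f : ∀ n, MvPolynomial (τ n) R} (hf : IsPBounded fun n => formulaComplexity (f n)) :
    IsPProjection f (fun n => immPoly 3 n R) := by
  obtain ⟨c, hc⟩ := hf
  refine ⟨fun n => 6 * (n ^ c + c + 1) ^ 16 + 1, ?_, fun n => ?_⟩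
  · exact IsPBounded.add_holds (IsPBounded.mul_holds (IsPBounded.const 6) (IsPBounded.pow_holds
      (IsPBounded.add_holds (IsPBounded.add_holds (IsPBounded.pow_holds IsPBounded.id c)
        (IsPBounded.const c)) (IsPBounded.const 1)) 16)) (IsPBounded.const 1)
  · exact isProjection_immPoly_three_of_formulaComplexity_le (f n) (hc n)

/-! ## §5. Membership: `E(IMM_{3,n}) = O(n³)` by divide and conquer

Bürgisser 2024, §2.3: "Using `M_1 ⋯ M_n = (M_1 ⋯ M_{n-1}) M_n`, we see that `g_n` has expression
size `O(n)`" — that count is for straight-line evaluation; as a *formula* (the tree's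
`formulaComplexity`, an expression tree without sharing) the linear recursion copies the nine
entries of the prefix product and is exponential, so we bound `E(IMM_{3,n})` by the balanced
product tree instead: `E(entry of a product of 2^j letters) + 1 ≤ 6^j`, whence
`E(IMM_{3,n}) ≤ 24 (n+1)^3`. -/

/-- `E(X_v) = 0` (a leaf; re-derived from the `WExpr` bridge to keep imports light).
[cite: BurgisserClausenShokrollahi1997, (21.19)] -/
private theorem formulaComplexity_X_le_zero' {τ : Type*} (v : τ) :
    formulaComplexity (X v : MvPolynomial τ R) ≤ 0 :=
  (exists_wexpr_iff_formulaComplexity_le _ 0).mp ⟨.var v, WExpr.eval_var v, le_rfl⟩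

/-- `E(C c) = 0` (a leaf). [cite: BurgisserClausenShokrollahi1997, (21.19)] -/
private theorem formulaComplexity_C_le_zero' {τ : Type*} (c : R) :
    formulaComplexity (C c : MvPolynomial τ R) ≤ 0 :=
  (exists_wexpr_iff_formulaComplexity_le _ 0).mp ⟨.const c, WExpr.eval_const c, le_rfl⟩

/-- One step of the balanced product tree: if the entries of `X` have `E + 1 ≤ p` and those of
`Y` have `E + 1 ≤ q`, the entries of `X Y` (three products, two sums each) have
`E + 1 ≤ 3 (p + q)`. [cite: Burgisser2024Completeness, §2.3 (p0007 L86–L88)] -/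
private theorem formulaComplexity_mul_apply_succ_le {τ : Type*}
    {X Y : Matrix (Fin 3) (Fin 3) (MvPolynomial τ R)} {p q : ℕ}
    (hX : ∀ a b, formulaComplexity (X a b) + 1 ≤ p)
    (hY : ∀ a b, formulaComplexity (Y a b) + 1 ≤ q) (a b : Fin 3) :
    formulaComplexity ((X * Y) a b) + 1 ≤ 3 * (p + q) := by
  rw [Matrix.mul_apply, Fin.sum_univ_three]
  have h0 := formulaComplexity_mul_le (X a 0) (Y 0 b)
  have h1 := formulaComplexity_mul_le (X a 1) (Y 1 b)
  have h2 := formulaComplexity_mul_le (X a 2) (Y 2 b)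
  have h01 := formulaComplexity_add_le (X a 0 * Y 0 b) (X a 1 * Y 1 b)
  have h012 := formulaComplexity_add_le (X a 0 * Y 0 b + X a 1 * Y 1 b) (X a 2 * Y 2 b)
  have := hX a 0; have := hX a 1; have := hX a 2
  have := hY 0 b; have := hY 1 b; have := hY 2 b
  omega

/-- **The balanced product tree**: the entries of a product of `2^j` matrices of format `3 × 3`
whose entries have expression size `0` (variables or constants) have expression size
`≤ 6^j - 1`. [cite: Burgisser2024Completeness, §2.3 (p0007 L86–L88)] -/
private theorem formulaComplexity_prod_apply_succ_le {τ : Type*} :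
    ∀ (j : ℕ) (Ms : List (Matrix (Fin 3) (Fin 3) (MvPolynomial τ R))), Ms.length = 2 ^ j →
      (∀ M ∈ Ms, ∀ a b, formulaComplexity (M a b) = 0) →
      ∀ a b, formulaComplexity (Ms.prod a b) + 1 ≤ 6 ^ j := by
  intro j
  induction j with
  | zero =>
    intro Ms hlen hMs a b
    obtain ⟨M, rfl⟩ : ∃ M, Ms = [M] := List.length_eq_one_iff.1 (by simpa using hlen)
    simp only [List.prod_cons, List.prod_nil, mul_one, pow_zero]
    have := hMs M (by simp) a b
    omega
  | succ j ih =>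
    intro Ms hlen hMs a b
    have hlt : (Ms.take (2 ^ j)).length = 2 ^ j := by
      rw [List.length_take, hlen, pow_succ]; exact min_eq_left (by omega)
    have hld : (Ms.drop (2 ^ j)).length = 2 ^ j := by
      rw [List.length_drop, hlen, pow_succ]; omega
    have h := formulaComplexity_mul_apply_succ_le
      (ih _ hlt fun M hM => hMs M (List.mem_of_mem_take hM))
      (ih _ hld fun M hM => hMs M (List.mem_of_mem_drop hM)) a b
    rw [← List.prod_append, List.take_append_drop] at h
    rw [pow_succ]
    omega

/-- **`E(IMM_{3,n}) ≤ 24 (n+1)^3`**: the membership half `(g_n) ∈ VF` of the `VF`-completeness of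
`g_n = tr(M_1 ⋯ M_n)` (Bürgisser 2024, §2.3), over every commutative ring, with an explicit
cubic bound from the balanced product tree (pad the `n` letters by unit matrices to `2^j`
factors, `n ≤ 2^j ≤ 2(n+1)`, so every entry of `M_1 ⋯ M_n` has `E + 1 ≤ 6^j ≤ 8^j ≤ 8(n+1)^3`,
and the trace adds three of them). [cite: Burgisser2024Completeness, §2.3 (p0007 L83–L88)] -/
theorem formulaComplexity_immPoly_three_le (n : ℕ) :
    formulaComplexity (immPoly 3 n R) ≤ 24 * (n + 1) ^ 3 := by
  classical
  let Xl : Fin n → Matrix (Fin 3) (Fin 3) (MvPolynomial (Fin n × Fin 3 × Fin 3) R) :=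
    fun t => Matrix.of fun i j => X (t, i, j)
  have himm : immPoly 3 n R = Matrix.trace ((List.finRange n).map Xl).prod := by
    have h := LayeredAutomaton.aeval_immPoly_eq_trace (K := R) (n := 3) (d := n)
      (X : Fin n × Fin 3 × Fin 3 → MvPolynomial (Fin n × Fin 3 × Fin 3) R)
    rwa [aeval_X_left, AlgHom.coe_id, id_eq] at h
  -- pad the letters by unit matrices to `2^j` factors, `j = log₂ n + 1`
  have hnj : n ≤ 2 ^ (Nat.log 2 n + 1) := (Nat.lt_pow_succ_log_self one_lt_two n).le
  have h2j : 2 ^ (Nat.log 2 n + 1) ≤ 2 * (n + 1) := by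
    rw [pow_succ]
    rcases Nat.eq_zero_or_pos n with rfl | hn
    · simp
    · have := Nat.pow_log_le_self 2 hn.ne'
      omega
  generalize Nat.log 2 n + 1 = j at hnj h2j
  let Ms : List (Matrix (Fin 3) (Fin 3) (MvPolynomial (Fin n × Fin 3 × Fin 3) R)) :=
    (List.finRange n).map Xl ++ List.replicate (2 ^ j - n) 1
  have hlen : Ms.length = 2 ^ j := by
    simp only [Ms, List.length_append, List.length_map, List.length_finRange,
      List.length_replicate]
    omega
  have hprod : Ms.prod = ((List.finRange n).map Xl).prod := by
    simp only [Ms, List.prod_append, List.prod_replicate, one_pow, mul_one]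
  have hMs : ∀ M ∈ Ms, ∀ a b, formulaComplexity (M a b) = 0 := by
    intro M hM a b
    rcases List.mem_append.1 hM with hM | hM
    · obtain ⟨t, _, rfl⟩ := List.mem_map.1 hM
      exact Nat.le_zero.1 (formulaComplexity_X_le_zero' (R := R) (t, a, b))
    · rw [List.eq_of_mem_replicate hM]
      by_cases hab : a = b
      · subst hab
        rw [Matrix.one_apply_eq, ← C_1]
        exact Nat.le_zero.1 (formulaComplexity_C_le_zero' (R := R) 1)
      · rw [Matrix.one_apply_ne hab, ← C_0]
        exact Nat.le_zero.1 (formulaComplexity_C_le_zero' (R := R) 0)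
  have hent := formulaComplexity_prod_apply_succ_le j Ms hlen hMs
  rw [hprod] at hent
  have h6 : 6 ^ j ≤ 8 * (n + 1) ^ 3 :=
    calc 6 ^ j ≤ 8 ^ j := Nat.pow_le_pow_left (by norm_num) j
      _ = (2 ^ j) ^ 3 := by rw [← pow_mul, mul_comm, pow_mul]; norm_num
      _ ≤ (2 * (n + 1)) ^ 3 := Nat.pow_le_pow_left h2j 3
      _ = 8 * (n + 1) ^ 3 := by ring
  generalize ((List.finRange n).map Xl).prod = P at himm hent
  rw [himm, Matrix.trace, Fin.sum_univ_three]
  simp only [Matrix.diag_apply]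
  have ha := formulaComplexity_add_le (P 0 0) (P 1 1)
  have hb := formulaComplexity_add_le (P 0 0 + P 1 1) (P 2 2)
  have := hent 0 0; have := hent 1 1; have := hent 2 2
  omega

/-- **`(IMM_{3,n})_n ∈ VF`**: p-bounded expression size (Bürgisser 2024, §2.3, "thus
`(g_n) ∈ VF`"), over every commutative ring. [cite: Burgisser2024Completeness, §2.3 (p0007 L83–L88)] -/
theorem isPBounded_formulaComplexity_immPoly_three (R : Type u) [CommRing R] :
    IsPBounded fun n => formulaComplexity (immPoly 3 n R) :=
  (IsPBounded.mul_holds (IsPBounded.const 24)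
    (IsPBounded.pow_holds (IsPBounded.add_holds IsPBounded.id (IsPBounded.const 1)) 3)).mono
    fun n => formulaComplexity_immPoly_three_le n

/-! ## §6. `VF`-completeness of `(tr(M_1 ⋯ M_n))_n`, `3 × 3` matrices -/

/-- **Bürgisser 2024, §2.3 (after Ben-Or–Cleve 1992): the sequence `g_n = tr(M_1 ⋯ M_n)`, the
`M_ν` being `3 × 3` matrices whose entries are different variables, is `VF`-complete** — here
`g_n = immPoly 3 n R = IMM_{3,n}` (the tree's trace form), `VF` rendered by p-bounded expression
size `IsPBounded (E ∘ f)` (`VF = VP_e`, Bürgisser 2024 Def. 2.8 / Cor. 2.14 (1)), completeness per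
Def. 2.16 (membership, and every `VF` family — in arbitrary variable types — is a p-projection),
over every commutative ring. The printed `t(m) = O(m²)` is realised as `6 (m+1)^{16} + 1`
(Brent's depth reduction with the tree's constant) — TODO(sharper form): `t(m) = O(m²)`.
[cite: Burgisser2024Completeness, §2.3 (p0007 L83–L92)] [cite: BenOrCleve1992, Thm. 1] -/
theorem Bur24_immPoly_three_VFComplete (R : Type u) [CommRing R] :
    (IsPBounded fun n => formulaComplexity (immPoly 3 n R)) ∧
      ∀ {τ : ℕ → Type v} (f : ∀ n, MvPolynomial (τ n) R),
        (IsPBounded fun n => formulaComplexity (f n)) → IsPProjection f (fun n => immPoly 3 n R) :=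
  ⟨isPBounded_formulaComplexity_immPoly_three R,
    fun _ => isPProjection_immPoly_three_of_isPBounded_formulaComplexity⟩

/-- **`VF` is exactly the class of p-projections of `(IMM_{3,n})_n`**: a family (in arbitrary
variable types, over every commutative ring) has p-bounded expression size iff it is a
p-projection of `(tr(M_1 ⋯ M_n))_n`, `3 × 3` matrices (completeness, and `VF` is closed under
p-projections, `isPBounded_formulaComplexity_of_isPProjection`).
[cite: Burgisser2024Completeness, §2.3 (p0007 L73–L92)] [cite: BenOrCleve1992, Thm. 1] -/
theorem isPBounded_formulaComplexity_iff_isPProjection_immPoly_three {τ : ℕ → Type v}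
    (f : ∀ n, MvPolynomial (τ n) R) :
    (IsPBounded fun n => formulaComplexity (f n)) ↔ IsPProjection f (fun n => immPoly 3 n R) :=
  ⟨isPProjection_immPoly_three_of_isPBounded_formulaComplexity,
    isPBounded_formulaComplexity_of_isPProjection (isPBounded_formulaComplexity_immPoly_three R)⟩

end BenOrCleve

end Literature.Computability.AlgebraicComplexity
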